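import Literature.Geometry.Kaehler.ComplexTorusDualPolarizationChernClass
import Literature.Geometry.Kaehler.ComplexTorusDualityAlphaP
import Literature.Geometry.Kaehler.ComplexTorusIntegralLefschetzFormDegreeOneDualType
import Literature.Geometry.Kaehler.ComplexTorusCycleClassPairing
import HarnessLib

/-!
# The `H¹` Lefschetz form of the minimal curve class is `d_g · η⁻¹`: `⟨γ_{g−1}, η(v, ·) ∧ η(w, ·)⟩ = ± d_g · η(v, w)`, i.e.
# `B₁ = ± E_δ/d₁` — the (primitive part of the) dual polarisation

Layer `Literature/Geometry/Kaehler`, namespace `Literature.Geometry.Kaehler.ComplexTorus`; lane `lit-hodgefound` (Track 2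
foundations library), seat p09, generation 42, row g42-#5. THEOREMS ONLY (0 definitions); no named fact, net debt 0. A bridge between
three threads of the tree: the integral `H¹` Lefschetz form `B₁(x, y) = ⟨x, γ_{g−1} ∧ y⟩` of the minimal class (g41-#6
`ComplexTorusIntegralLefschetzFormDegreeOneDualType`: a symplectic lattice of type `(1, d_g/d_{g−1}, …, d_g/d₁)`; g42-#1: any presentation),
Lange's Exercise 2.5.4 (6)(a) (`ComplexTorusDualPolarizationChernClass`, prover p16: `∫_X η^{∧(g−1)} ∧ η(v,·) ∧ η(w,·) = (−1)^g (g−1)! d₁⋯d_g · η(v, w)`)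
and the dual polarisation `E_δ = d₁d_g · E^*` (`ComplexTorusDualPolarizationType`, prover p26; Lange Prop. 2.5.1).

THE RESULT. Let `(X = E/Φ(ℤ^ι), η)` be a polarised complex torus of type `(d₁, …, d_g)` (`g = n + 1`, ANY presentation), `θ = ofRealForm η`,
`m = γ_{g−1}` the minimal curve class (`θ^{∧(g−1)} = ((g−1)!·d₁⋯d_{g−1})·m`), `e` an orientation of the lattice basis, and for `v ∈ E` let
`η(v, ·)` be the contraction covector (`twoFormLeft η v`; these covectors are ALL of `H¹(X, ℝ) = Hom_ℝ(E, ℝ)`, `η` being non-degenerate).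
Then (§1)

  **`⟨m, η(v, ·) ∧ η(w, ·)⟩_e = (−1)^g · sign_X(e) · d_g · η(v, w)`**   (`sign_X(e) = orientationSign Φ e`),

i.e. the bilinear form `(α, β) ↦ ⟨γ_{g−1}, α ∧ β⟩` on `H¹(X, ℝ)` is `± d_g · η⁻¹` (`η⁻¹(η(v,·), η(w,·)) = η(v, w)`). §2 reads this through Lang's
`φ_H : E ⥲ Ω̄` (`Im φ_H(v) = η(v, ·)`, `E^*(φ_H v, φ_H w) = η(v, w)`): for all `ξ, ζ ∈ Ω̄ = H₁(X̂, ℝ)`,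

  **`⟨m, Im ξ ∧ Im ζ⟩_e = (−1)^g · sign_X(e) · d_g · E^*(ξ, ζ) = ((−1)^g sign_X(e)/d₁) · E_δ(ξ, ζ)`**,

`E_δ = d₁d_g E^*` the Riemann form of the dual polarisation `L_δ` on `X̂` (type `(d₁, d₁d_g/d_{g−1}, …, d_g)`, `IsPolarizationType.dual`):
under `H¹(X, ℝ) ∋ Im ξ ↤ ξ ∈ H₁(X̂, ℝ)` the Lefschetz form of the minimal curve class IS `± E_δ/d₁` — which explains the type
`(1, d_g/d_{g−1}, …, d_g/d₁) = d₁⁻¹ · (d₁, d₁d_g/d_{g−1}, …, d_g)` found in g41-#6. §3 gives the `B₁` reading `⟨α, m ∧ β⟩ = ⟨m, α ∧ β⟩`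
(graded commutativity and associativity of `∧`, `m` of even degree).

Sources: Lange 2023 §2.5.4 Exercise (6)(a) (PDF p. 136: `c₁(L_δ) = (1/((g−1)! d₂⋯d_{g−1})) α(c₁(L))`, `α = ε ∘ P⁻¹ ∘ L^{g−2}`), §2.5.1
Prop. 2.5.1 (PDF p. 129: `c₁(L_δ) = d₁d_g c₁(L)⁻¹`, type of `L_δ`), §1.4.2 Lemma 1.4.5 (`φ_H`), §1.7.2 Lemma 1.7.5 (`∫ η^{∧g}`), §5.4.1 (5.22)
(PDF p. 275), §2.5.3 Cor. 2.5.17 (c) (PDF p. 135: `{D}^{g−1}/(g−1)!`); Lang 1982 Ch. VII §5 Thm. 5.2 (the transport `E^*`); Birkenhake–Lange,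
*The dual polarization of an abelian variety*, Arch. Math. 73 (1999) (via LangeBirkenhake1992 §14.4); Benoist–Debarre 2023 §1 (minimal classes).

## Contents (theorems only)

* §1 `IsPolarizationType.torusIntegral_wedge_twoFormLeft_of_eq_content_smul` (`∫_X m ∧ η(v,·) ∧ η(w,·) = (−1)^g d_g η(v, w)`),
  **`IsPolarizationType.poincarePairing_wedgeOne_twoFormLeft_of_eq_content_smul`** (the pairing form), existence form.
* §2 `imOfAntidual_phiHFun`, **`IsPolarizationType.poincarePairing_wedgeOne_imOfAntidual_eq_dualForm_of_eq_content_smul`** (`E^*`),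
  `IsPolarizationType.poincarePairing_wedgeOne_imOfAntidual_eq_dualPolarization_of_eq_content_smul` (`E_δ/d₁`).
* §3 `poincarePairing_one_wedge_eq_poincarePairing_wedge` (`⟨α, z ∧ β⟩ = ⟨z, α ∧ β⟩` for `1`-forms `α, β` and `z` of even degree) and the
  `B₁` readings `IsPolarizationType.poincarePairing_twoFormLeft_wedge_of_eq_content_smul`.

## References

* [cite: Lange2023AbelianVarietiesComplex, §2.5.4 Exercise (6)(a) (PDF p. 136); §2.5.1 Prop. 2.5.1 (PDF p. 129); §1.4.2 Lemma 1.4.5; §1.7.2 Lemma 1.7.5; §2.5.3 Cor. 2.5.17 (c) (PDF p. 135); §5.4.1 (5.22) (PDF p. 275)]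
* [cite: Lang1982AbelianFunctions, Ch. VII §5 Thm. 5.2, pp. 119–120]
* [cite: LangeBirkenhake1992, §14.4 (the dual polarization)]
* [cite: BenoistDebarre2023SmoothSubvarietiesJacobians, §1 (p. 3)]
-/

noncomputable section

open Module Function
open Literature.LinearAlgebra.Alternating

namespace Literature.Geometry.Kaehler.ComplexTorus

section DegreeOneDual

variable {ι : Type*} [Fintype ι] [DecidableEq ι] {E : Type*} [NormedAddCommGroup E] [NormedSpace ℂ E]
  (Φ : (ι → ℝ) ≃L[ℝ] E) {n : ℕ} {η : E [⋀^Fin 2]→L[ℝ] ℝ} {d : Fin (n + 1) → ℕ}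

omit [Fintype ι] [DecidableEq ι] in
/-- The content of `θ^{∧g}` over that of `θ^{∧(g−1)}`: `∏_{i ≤ g−1} d_i = (∏_{i < g−1} d_i) · d_g` (`g = n + 1`, indices `Fin (n+1)`).
[cite: Lange2023AbelianVarietiesComplex, §2.5.3 Thm. 2.5.16 (PDF p. 135)] -/
private theorem prod_eq_prod_castLE_mul_last₅₅ (hle : n ≤ n + 1) :
    ∏ i : Fin (n + 1), (d i : ℂ) = (∏ i : Fin n, (d (Fin.castLE hle i) : ℂ)) * d (Fin.last n) := by
  rw [Fin.prod_univ_castSucc]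
  exact congrArg₂ (· * ·) (Finset.prod_congr rfl fun i _ ↦ congrArg (fun j ↦ (d j : ℂ)) (Fin.ext rfl)) rfl

/-! ## §1 `⟨γ_{g−1}, η(v, ·) ∧ η(w, ·)⟩ = (−1)^g · sign_X(e) · d_g · η(v, w)` -/

/-- **`∫_X γ_{g−1} ∧ η(v,·) ∧ η(w,·) = (−1)^g · d_g · η(v, w)`** for the minimal curve class `m = γ_{g−1}` of a polarised torus of type
`(d₁, …, d_g)` (`g = n + 1`; any presentation): p16's `∫_X η^{∧(g−1)} ∧ η(v,·) ∧ η(w,·) = (−1)^g (g−1)! d₁⋯d_g η(v, w)` divided by the content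
`(g−1)!·d₁⋯d_{g−1}`. [cite: Lange2023AbelianVarietiesComplex, §2.5.4 Exercise (6)(a) (PDF p. 136); §1.7.2 Lemma 1.7.5; §2.5.3 Cor. 2.5.17 (c) (PDF p. 135)] -/
theorem IsPolarizationType.torusIntegral_wedge_twoFormLeft_of_eq_content_smul {Φ : (ι → ℝ) ≃L[ℝ] E} (hd : IsPolarizationType Φ η d)
    (hη : IsRiemannForm Φ η) (e : Fin (2 * n + 2) ≃ ι) (hle : n ≤ n + 1) {m : E [⋀^Fin (2 * n)]→L[ℝ] ℂ}
    (hm : wedgePow (ofRealForm η) n = ((n.factorial * ∏ i : Fin n, d (Fin.castLE hle i) : ℕ) : ℂ) • m) (v w : E) :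
    torusIntegral Φ e ((m.wedge (wedgeOne (twoFormLeft η v) (wedgeOne (twoFormLeft η w)
        (ContinuousAlternatingMap.constOfIsEmpty ℝ E (Fin 0) (1 : ℂ))) : E [⋀^Fin 2]→L[ℝ] ℂ))) =
      (-1) ^ (n + 1) * (d (Fin.last n) : ℂ) * η ![v, w] := by
  have h := hη.torusIntegral_wedgePow_wedge_twoFormLeft Φ hd e v w
  have hc : ((n.factorial * ∏ i : Fin n, d (Fin.castLE hle i) : ℕ) : ℂ) ≠ 0 := by
    exact_mod_cast (Nat.mul_pos (Nat.factorial_pos n) (Finset.prod_pos fun i _ ↦ hd.pos hη _)).ne'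
  rw [hm, wedge_smul_left_complex, torusIntegral_smul, prod_eq_prod_castLE_mul_last₅₅ hle] at h
  have h' : ((n.factorial * ∏ i : Fin n, d (Fin.castLE hle i) : ℕ) : ℂ) *
      torusIntegral Φ e (m.wedge (wedgeOne (twoFormLeft η v) (wedgeOne (twoFormLeft η w)
        (ContinuousAlternatingMap.constOfIsEmpty ℝ E (Fin 0) (1 : ℂ))) : E [⋀^Fin 2]→L[ℝ] ℂ)) =
      ((n.factorial * ∏ i : Fin n, d (Fin.castLE hle i) : ℕ) : ℂ) * ((-1) ^ (n + 1) * (d (Fin.last n) : ℂ) * η ![v, w]) := by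
    rw [h]; push_cast; ring
  exact mul_left_cancel₀ hc h'

/-- **`⟨γ_{g−1}, η(v, ·) ∧ η(w, ·)⟩_e = (−1)^g · sign_X(e) · d_g · η(v, w)`**: the bilinear form `(α, β) ↦ ⟨γ_{g−1}, α ∧ β⟩` on
`H¹(X, ℝ) = {η(v, ·)}` is `± d_g · η⁻¹` — for every polarised complex torus of type `(d₁, …, d_g)` (`g = n + 1`), any presentation, any
orientation `e`. Compare g41-#6: on `H¹(X, ℤ)` it is a symplectic lattice of type `(1, d_g/d_{g−1}, …, d_g/d₁) = d_g · (1/d_g, …, 1/d₁)`.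
[cite: Lange2023AbelianVarietiesComplex, §2.5.4 Exercise (6)(a) (PDF p. 136); §2.5.1 Prop. 2.5.1 (PDF p. 129); §5.4.1 (5.22) (PDF p. 275)] [cite: BenoistDebarre2023SmoothSubvarietiesJacobians, §1 (p. 3)] -/
theorem IsPolarizationType.poincarePairing_wedgeOne_twoFormLeft_of_eq_content_smul {Φ : (ι → ℝ) ≃L[ℝ] E}
    (hd : IsPolarizationType Φ η d) (hη : IsRiemannForm Φ η) (e : Fin (2 * n + 2) ≃ ι) (hle : n ≤ n + 1)
    {m : E [⋀^Fin (2 * n)]→L[ℝ] ℂ} (hm : wedgePow (ofRealForm η) n = ((n.factorial * ∏ i : Fin n, d (Fin.castLE hle i) : ℕ) : ℂ) • m)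
    (v w : E) :
    poincarePairing Φ e rfl m (wedgeOne (twoFormLeft η v) (wedgeOne (twoFormLeft η w)
        (ContinuousAlternatingMap.constOfIsEmpty ℝ E (Fin 0) (1 : ℂ))) : E [⋀^Fin 2]→L[ℝ] ℂ) =
      (-1) ^ (n + 1) * orientationSign Φ e * (d (Fin.last n) : ℂ) * η ![v, w] := by
  have h := torusIntegral_wedge_eq_orientationSign_mul_poincarePairing' Φ e m
    (wedgeOne (twoFormLeft η v) (wedgeOne (twoFormLeft η w) (ContinuousAlternatingMap.constOfIsEmpty ℝ E (Fin 0) (1 : ℂ))) :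
      E [⋀^Fin 2]→L[ℝ] ℂ)
  rw [hd.torusIntegral_wedge_twoFormLeft_of_eq_content_smul hη e hle hm] at h
  have hs : ((orientationSign Φ e : ℤ) : ℂ) * orientationSign Φ e = 1 := by
    rw [← Int.cast_mul, orientationSign_mul_self, Int.cast_one]
  calc _ = ((orientationSign Φ e : ℤ) : ℂ) * (orientationSign Φ e * poincarePairing Φ e rfl m
        (wedgeOne (twoFormLeft η v) (wedgeOne (twoFormLeft η w) (ContinuousAlternatingMap.constOfIsEmpty ℝ E (Fin 0) (1 : ℂ))) :
          E [⋀^Fin 2]→L[ℝ] ℂ)) := by rw [← mul_assoc, hs, one_mul]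
    _ = _ := by rw [← h]; ring

/-- **Existence form**: every polarised torus of type `(d₁, …, d_g)` (`g = n + 1`) carries the integral minimal curve class `γ_{g−1} ∈ H^{2g−2}(X, ℤ)`
with `⟨γ_{g−1}, η(v,·) ∧ η(w,·)⟩_e = (−1)^g sign_X(e) d_g η(v, w)` for all `v, w`.
[cite: Lange2023AbelianVarietiesComplex, §2.5.4 Exercise (6)(a) (PDF p. 136); §2.5.3 Thm. 2.5.16 and Cor. 2.5.17 (c) (PDF p. 135)] [cite: BenoistDebarre2023SmoothSubvarietiesJacobians, §1 (p. 3)] -/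
theorem IsPolarizationType.exists_minimalClass_poincarePairing_wedgeOne_twoFormLeft {Φ : (ι → ℝ) ≃L[ℝ] E}
    (hd : IsPolarizationType Φ η d) (hη : IsRiemannForm Φ η) (e : Fin (2 * n + 2) ≃ ι) (hle : n ≤ n + 1) :
    ∃ m ∈ integralForms Φ (2 * n), wedgePow (ofRealForm η) n = ((n.factorial * ∏ i : Fin n, d (Fin.castLE hle i) : ℕ) : ℂ) • m ∧
      ∀ v w : E, poincarePairing Φ e rfl m (wedgeOne (twoFormLeft η v) (wedgeOne (twoFormLeft η w)
          (ContinuousAlternatingMap.constOfIsEmpty ℝ E (Fin 0) (1 : ℂ))) : E [⋀^Fin 2]→L[ℝ] ℂ) =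
        (-1) ^ (n + 1) * orientationSign Φ e * (d (Fin.last n) : ℂ) * η ![v, w] := by
  obtain ⟨m, hmZ, hm⟩ := hd.exists_mem_integralForms_wedgePow_eq_content_smul hle
  exact ⟨m, hmZ, hm, fun v w ↦ hd.poincarePairing_wedgeOne_twoFormLeft_of_eq_content_smul hη e hle hm v w⟩

/-! ## §2 Through `φ_H : E ⥲ Ω̄`: `⟨γ_{g−1}, Im ξ ∧ Im ζ⟩ = ± d_g · E^*(ξ, ζ) = ± E_δ(ξ, ζ)/d₁` -/

omit [Fintype ι] [DecidableEq ι] Φ in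
/-- `Im φ_H(v) = η(v, ·)` as covectors (Lemma 1.4.5). [cite: Lange2023AbelianVarietiesComplex, §1.4.2 Lemma 1.4.5] -/
theorem imOfAntidual_phiHFun (η : E [⋀^Fin 2]→L[ℝ] ℝ) (v : E) : imOfAntidual (phiHFun η v) = twoFormLeft η v := by
  ext w
  rw [imOfAntidual_apply, im_phiHFun, twoFormLeft_apply]

/-- **`⟨γ_{g−1}, Im ξ ∧ Im ζ⟩_e = (−1)^g · sign_X(e) · d_g · E^*(ξ, ζ)` for all antifunctionals `ξ, ζ ∈ Ω̄ = H₁(X̂, ℝ)`** (`g = n + 1`; `E^*` Lang's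
transport `dualForm`, `E^*(φ_H v, φ_H w) = η(v, w)`): the Lefschetz form of the minimal curve class on `H¹(X, ℝ) = {Im ξ}` is `± d_g E^*`.
[cite: Lange2023AbelianVarietiesComplex, §2.5.4 Exercise (6)(a) (PDF p. 136); §2.5.1 Prop. 2.5.1 (PDF p. 129); §1.4.2 Lemma 1.4.5] [cite: Lang1982AbelianFunctions, Ch. VII §5 Thm. 5.2, pp. 119–120] -/
theorem IsPolarizationType.poincarePairing_wedgeOne_imOfAntidual_eq_dualForm_of_eq_content_smul {Φ : (ι → ℝ) ≃L[ℝ] E}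
    (hd : IsPolarizationType Φ η d) (hη : IsRiemannForm Φ η) (e : Fin (2 * n + 2) ≃ ι) (hle : n ≤ n + 1)
    {m : E [⋀^Fin (2 * n)]→L[ℝ] ℂ} (hm : wedgePow (ofRealForm η) n = ((n.factorial * ∏ i : Fin n, d (Fin.castLE hle i) : ℕ) : ℂ) • m)
    (ξ ζ : E →L⋆[ℂ] ℂ) :
    poincarePairing Φ e rfl m (wedgeOne (imOfAntidual ξ) (wedgeOne (imOfAntidual ζ)
        (ContinuousAlternatingMap.constOfIsEmpty ℝ E (Fin 0) (1 : ℂ))) : E [⋀^Fin 2]→L[ℝ] ℂ) =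
      (-1) ^ (n + 1) * orientationSign Φ e * (d (Fin.last n) : ℂ) * dualForm Φ hη.1 hη.nondegenerate ![ξ, ζ] := by
  obtain ⟨v, rfl⟩ : ∃ v, phiHFun η v = ξ := ⟨(phiHEquiv Φ hη.1 hη.nondegenerate).symm ξ, phiHFun_phiHEquiv_symm_apply Φ _ _ ξ⟩
  obtain ⟨w, rfl⟩ : ∃ w, phiHFun η w = ζ := ⟨(phiHEquiv Φ hη.1 hη.nondegenerate).symm ζ, phiHFun_phiHEquiv_symm_apply Φ _ _ ζ⟩
  rw [imOfAntidual_phiHFun, imOfAntidual_phiHFun, dualForm_apply_phiHFun,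
    hd.poincarePairing_wedgeOne_twoFormLeft_of_eq_content_smul hη e hle hm v w]

/-- **`d₁ · ⟨γ_{g−1}, Im ξ ∧ Im ζ⟩_e = (−1)^g · sign_X(e) · E_δ(ξ, ζ)`**, `E_δ = d₁d_g · E^*` the Riemann form of the DUAL POLARISATION `L_δ` on `X̂`
(of type `(d₁, d₁d_g/d_{g−1}, …, d_g)`, `IsPolarizationType.dual`): up to the sign and the factor `d₁`, the `H¹` Lefschetz form of the minimal
curve class is the dual polarisation read on `H₁(X̂, ℝ) = Ω̄ ≅ H¹(X, ℝ)`. [cite: Lange2023AbelianVarietiesComplex, §2.5.1 Prop. 2.5.1 (PDF p. 129); §2.5.4 Exercise (6)(a) (PDF p. 136)] [cite: LangeBirkenhake1992, §14.4] -/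
theorem IsPolarizationType.poincarePairing_wedgeOne_imOfAntidual_eq_dualPolarization_of_eq_content_smul {Φ : (ι → ℝ) ≃L[ℝ] E}
    (hd : IsPolarizationType Φ η d) (hη : IsRiemannForm Φ η) (e : Fin (2 * n + 2) ≃ ι) (hle : n ≤ n + 1)
    {m : E [⋀^Fin (2 * n)]→L[ℝ] ℂ} (hm : wedgePow (ofRealForm η) n = ((n.factorial * ∏ i : Fin n, d (Fin.castLE hle i) : ℕ) : ℂ) • m)
    (ξ ζ : E →L⋆[ℂ] ℂ) :
    (d 0 : ℂ) * poincarePairing Φ e rfl m (wedgeOne (imOfAntidual ξ) (wedgeOne (imOfAntidual ζ)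
        (ContinuousAlternatingMap.constOfIsEmpty ℝ E (Fin 0) (1 : ℂ))) : E [⋀^Fin 2]→L[ℝ] ℂ) =
      (-1) ^ (n + 1) * orientationSign Φ e *
        ((((d 0 * d (Fin.last n) : ℕ) : ℝ) • dualForm Φ hη.1 hη.nondegenerate) ![ξ, ζ] : ℝ) := by
  rw [hd.poincarePairing_wedgeOne_imOfAntidual_eq_dualForm_of_eq_content_smul hη e hle hm, ContinuousAlternatingMap.smul_apply,
    smul_eq_mul]
  push_cast
  ring

end DegreeOneDual

/-! ## §3 The `B₁` reading: `⟨α, z ∧ β⟩ = ⟨z, α ∧ β⟩` for `1`-forms `α, β` and `z` of even degree -/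

section Reading

variable {ι : Type*} [Fintype ι] [DecidableEq ι] {E : Type*} [NormedAddCommGroup E] [NormedSpace ℂ E]
  (Φ : (ι → ℝ) ≃L[ℝ] E) {n N : ℕ}

omit [Fintype ι] in
/-- **`⟨α, z ∧ β⟩ = ⟨z, α ∧ β⟩`** for `1`-forms `α, β` and a form `z` of even degree `2n` (`1 + (2n + 1) = 2n + 2 = N`): graded commutativity
`⟨α, z ∧ β⟩ = −⟨z ∧ β, α⟩`, associativity `(z ∧ β) ∧ α = z ∧ (β ∧ α)` and `β ∧ α = −α ∧ β`. [cite: WarnerGTM94, 2.6] [cite: Lange2023AbelianVarietiesComplex, §6.2.4 (PDF p. 310)] -/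
theorem poincarePairing_one_wedge_eq_poincarePairing_wedge (e : Fin N ≃ ι) (h₁ : 1 + (2 * n + 1) = N) (h₂ : 2 * n + (1 + 1) = N)
    (z : E [⋀^Fin (2 * n)]→L[ℝ] ℂ) (α β : E [⋀^Fin 1]→L[ℝ] ℂ) :
    poincarePairing Φ e h₁ α (z.wedge β) = poincarePairing Φ e h₂ z (α.wedge β) := by
  have h₃ : (2 * n + 1) + 1 = N := by omega
  have hA := poincarePairing_comm Φ e h₃ h₁ (z.wedge β) α
  have hsign : ((-1 : ℂ)) ^ ((2 * n + 1) * 1) = -1 := by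
    rw [mul_one, pow_succ, pow_mul, neg_one_sq, one_pow, one_mul]
  have hc : (orderedBasis Φ e ∘ Fin.cast h₃) ∘ ⇑(finCongr (Nat.add_assoc (2 * n) 1 1).symm) = orderedBasis Φ e ∘ Fin.cast h₂ := by
    funext i; rfl
  have hB : poincarePairing Φ e h₃ (z.wedge β) α = -poincarePairing Φ e h₂ z (α.wedge β) := by
    rw [poincarePairing_apply, poincarePairing_apply, ContinuousAlternatingMap.WedgeAssoc_holds ℝ E ℂ z β α,
      ContinuousAlternatingMap.domDomCongr_apply, hc, wedge_comm_of_odd_complex odd_one α β,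
      show -(α.wedge β) = (-1 : ℂ) • α.wedge β from (neg_one_smul ℂ _).symm, wedge_smul_right_complex,
      ContinuousAlternatingMap.smul_apply, smul_eq_mul, neg_one_mul]
  rw [hA, hsign, hB, neg_one_mul, neg_neg]

omit [Fintype ι] [DecidableEq ι] Φ in
/-- The wedge of the `1`-forms of two covectors is the `2`-form `θ ∧ θ' ∧ 1`. [cite: Warner1983, 2.6] -/
theorem wedgeSeq_one_wedge_wedgeSeq_one_eq (θ θ' : E →L[ℝ] ℝ) :
    (wedgeSeq (ContinuousAlternatingMap.constOfIsEmpty ℝ E (Fin 0) (1 : ℂ)) 1 fun _ ↦ θ).wedge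
        (wedgeSeq (ContinuousAlternatingMap.constOfIsEmpty ℝ E (Fin 0) (1 : ℂ)) 1 fun _ ↦ θ') =
      (wedgeOne θ (wedgeOne θ' (ContinuousAlternatingMap.constOfIsEmpty ℝ E (Fin 0) (1 : ℂ))) : E [⋀^Fin 2]→L[ℝ] ℂ) := by
  rw [wedgeSeq_one_wedge_wedgeSeq_one 1 (fun _ ↦ θ) (fun _ ↦ θ')]
  rfl

variable {η : E [⋀^Fin 2]→L[ℝ] ℝ} {d : Fin (n + 1) → ℕ}

/-- **The `B₁` reading: `B₁(η(v,·), η(w,·)) = ⟨η(v,·), γ_{g−1} ∧ η(w,·)⟩_e = (−1)^g · sign_X(e) · d_g · η(v, w)`** — the integral Lefschetz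
form of the minimal curve class on `H¹(X)` (g41-#6) evaluated on contraction covectors (`g = n + 1`, any presentation).
[cite: Lange2023AbelianVarietiesComplex, §2.5.4 Exercise (6)(a) (PDF p. 136); §2.5.1 Prop. 2.5.1 (PDF p. 129); §5.4.1 (5.22) (PDF p. 275)] [cite: BenoistDebarre2023SmoothSubvarietiesJacobians, §1 (p. 3)] -/
theorem IsPolarizationType.poincarePairing_twoFormLeft_wedge_of_eq_content_smul {Φ : (ι → ℝ) ≃L[ℝ] E}
    (hd : IsPolarizationType Φ η d) (hη : IsRiemannForm Φ η) (e : Fin (2 * n + 2) ≃ ι) (hle : n ≤ n + 1)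
    {m : E [⋀^Fin (2 * n)]→L[ℝ] ℂ} (hm : wedgePow (ofRealForm η) n = ((n.factorial * ∏ i : Fin n, d (Fin.castLE hle i) : ℕ) : ℂ) • m)
    (h₁ : 1 + (2 * n + 1) = 2 * n + 2) (v w : E) :
    poincarePairing Φ e h₁ (wedgeSeq (ContinuousAlternatingMap.constOfIsEmpty ℝ E (Fin 0) (1 : ℂ)) 1 fun _ ↦ twoFormLeft η v)
        (m.wedge (wedgeSeq (ContinuousAlternatingMap.constOfIsEmpty ℝ E (Fin 0) (1 : ℂ)) 1 fun _ ↦ twoFormLeft η w)) =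
      (-1) ^ (n + 1) * orientationSign Φ e * (d (Fin.last n) : ℂ) * η ![v, w] := by
  rw [poincarePairing_one_wedge_eq_poincarePairing_wedge Φ e h₁ rfl, wedgeSeq_one_wedge_wedgeSeq_one_eq,
    hd.poincarePairing_wedgeOne_twoFormLeft_of_eq_content_smul hη e hle hm v w]

/-- **The `B₁` reading on `Ω̄`: `⟨Im ξ, γ_{g−1} ∧ Im ζ⟩_e = (−1)^g · sign_X(e) · d_g · E^*(ξ, ζ)`** for all `ξ, ζ ∈ Ω̄ = H₁(X̂, ℝ)`.
[cite: Lange2023AbelianVarietiesComplex, §2.5.4 Exercise (6)(a) (PDF p. 136); §2.5.1 Prop. 2.5.1 (PDF p. 129)] [cite: Lang1982AbelianFunctions, Ch. VII §5 Thm. 5.2, pp. 119–120] -/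
theorem IsPolarizationType.poincarePairing_imOfAntidual_wedge_eq_dualForm_of_eq_content_smul {Φ : (ι → ℝ) ≃L[ℝ] E}
    (hd : IsPolarizationType Φ η d) (hη : IsRiemannForm Φ η) (e : Fin (2 * n + 2) ≃ ι) (hle : n ≤ n + 1)
    {m : E [⋀^Fin (2 * n)]→L[ℝ] ℂ} (hm : wedgePow (ofRealForm η) n = ((n.factorial * ∏ i : Fin n, d (Fin.castLE hle i) : ℕ) : ℂ) • m)
    (h₁ : 1 + (2 * n + 1) = 2 * n + 2) (ξ ζ : E →L⋆[ℂ] ℂ) :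
    poincarePairing Φ e h₁ (wedgeSeq (ContinuousAlternatingMap.constOfIsEmpty ℝ E (Fin 0) (1 : ℂ)) 1 fun _ ↦ imOfAntidual ξ)
        (m.wedge (wedgeSeq (ContinuousAlternatingMap.constOfIsEmpty ℝ E (Fin 0) (1 : ℂ)) 1 fun _ ↦ imOfAntidual ζ)) =
      (-1) ^ (n + 1) * orientationSign Φ e * (d (Fin.last n) : ℂ) * dualForm Φ hη.1 hη.nondegenerate ![ξ, ζ] := by
  rw [poincarePairing_one_wedge_eq_poincarePairing_wedge Φ e h₁ rfl, wedgeSeq_one_wedge_wedgeSeq_one_eq,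
    hd.poincarePairing_wedgeOne_imOfAntidual_eq_dualForm_of_eq_content_smul hη e hle hm ξ ζ]

end Reading

end Literature.Geometry.Kaehler.ComplexTorus
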